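import Literature.IUT.LogVolume.TensorPacketOrbitVolume
import HarnessLib

/-!
# The hull of the log-shell lattice is a translate of `(R_I)^∼`: `hull(log_p(R_I^×)) = (⊗_i z_i^max)·(R_I)^∼`,
# `log μ̄(hull(log_p(R_I^×))) = Σ_i log‖z_i^max‖` (tame case: `= −Σ_i (1/e_i)·log p`)
# (Dupuy–Hilado §4.12; [IUTchIV] Prop. 1.2 (i), Prop. 1.4)

abc-iut cell, prover seat abc-iut-w5-d082 (item XXVIIc of `HOME/skel/FORK-REAL-MODEL.md` §4). In abc-iut-w5-d180's
exact formula for the Θ-hull at a summand of the real packet (`TensorPacketOrbitVolume`, `ForkPacketHullContent`),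

  `log μ̄(hull(⋃_{γ ∈ Ind2} γ·M)) = −m·log p + H`,   `H := log μ̄(hull(log_p(R_I^×)))`,

the term `H` was left symbolic ("its evaluation is [IUTchIV] Prop. 1.4 (iii) bookkeeping"). HERE `H` is EVALUATED in
classical per-field terms. For each factor `k_i` the compact open subgroup `log_p(R_i^×) ⊆ k_i` has an element `z_i^max`
of LARGEST norm (`exists_norm_isMaxOn_logUnits`; `‖z_i^max‖ > 0`); then

* `logPacket_subset_purePacket_smul_normalizedPacket_of_isMaxOn`: `log_p(R_I^×) ⊆ (⊗_i z_i^max)·(R_I)^∼` (a generator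
  `⊗z_i`, `z_i ∈ log_p(R_i^×)`, is `(⊗z_i^max)·⊗(z_i/z_i^max)` with `‖z_i/z_i^max‖ ≤ 1`);
* **`packetHull_logPacket_eq_purePacket_smul`**: `hull(log_p(R_I^×)) = (⊗_i z_i^max)·(R_I)^∼` (the translate is
  hull-closed and contains the hull; conversely `⊗z_i^max ∈ log_p(R_I^×)` and the hull is an `(R_I)^∼`-module);
* **`packetLogμ_packetHull_logPacket_eq_sum`**: `H = Σ_i log‖z_i^max‖` — so `H` depends on the packet only through the
  numbers `max{‖log_p(u)‖ : u ∈ R_i^×}`, one per tensor factor, each in `[p^{−a_i}, p^{b_i}]` by [IUTchIV] Prop. 1.2 (i)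
  (`rpow_neg_logRadiusA_le_norm_of_isMaxOn`, `norm_le_rpow_logRadiusB_of_mem_logUnits`), whence
  `−a_I·log p ≤ H ≤ b_I·log p` (`packetLogμ_packetHull_logPacket_mem_Icc`);
* TAME CASE (`p > 2`, every `e_i ≤ p − 2`, where Prop. 1.2 (i) is an equality `log_p(R_i^×) = p^{1/e_i}·R_i = 𝔪_i`):
  `‖z_i^max‖ = p^{−1/e_i}` (`norm_eq_of_isMaxOn_logUnits_of_tame`) and **`H = −(Σ_i 1/e_i)·log p = b_I·log p`**
  (`packetLogμ_packetHull_logPacket_eq_of_tame`): the upper estimate `H ≤ b_I·log p` used in [IUTchIV] Thm. 1.10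
  Step (v) is attained exactly at tame packets.

[cite: DupuyHilado2025, §4.12] [cite: Mochizuki2012, IUTchIV Prop. 1.2 (i) p. 10, Prop. 1.4 (iii) p. 13] Classical
`p`-adic algebra; (Ind2)/the hull are the tree's typings of disputed-corpus constructions [claim: Mochizuki2012, status:
disputed]; nothing here takes a side on [IUTchIII] Cor. 3.12. PROOF-ONLY file: no definitions, no named `Prop` facts.
-/

noncomputable section

open Set Module
open scoped Pointwise TensorProduct

namespace Literature.IUT.LogVolume

variable (p : ℕ) [Fact p.Prime]

/-! ## One factor: the element of largest norm in `log_p(R^×)` -/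

section Factor

variable (K : Type) [NontriviallyNormedField K] [NormedAlgebra ℚ_[p] K] [IsUltrametricDist K] [ProperSpace K]

include p in
/-- **`log_p(R^×)` has an element of largest norm** (it is compact and nonempty, the norm is continuous; the prime `p`
enters through the `ℚ_p`-algebra structure used for compactness). [cite: Mochizuki2012, IUTchIV Prop. 1.2 (i) p. 10] -/
theorem exists_norm_isMaxOn_logUnits : ∃ z ∈ logUnits K, ∀ w ∈ logUnits K, ‖w‖ ≤ ‖z‖ :=
  (isCompact_logUnits p K).exists_isMaxOn ⟨0, zero_mem_logUnits (p := p)⟩ continuous_norm.continuousOn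

/-- `p² ∈ log_p(R^×)` (the ball `{‖z‖ ≤ p⁻²}` lies in `log_p(R^×)`). [cite: Mochizuki2012, IUTchIV Prop. 1.2 (i) p. 10] -/
theorem prime_sq_mem_logUnits : ((p : K) ^ 2) ∈ logUnits K := by
  refine closedBall_subset_logUnits p K ?_
  rw [Set.mem_setOf_eq, norm_pow, norm_prime p K, ← Real.rpow_natCast, ← Real.rpow_neg_one, ← Real.rpow_mul
    (by exact_mod_cast (Fact.out : p.Prime).pos.le)]
  norm_num

include p in
/-- An element of largest norm in `log_p(R^×)` is nonzero: its norm is at least `‖p²‖ = p⁻² > 0`.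
[cite: Mochizuki2012, IUTchIV Prop. 1.2 (i) p. 10] -/
theorem norm_pos_of_isMaxOn_logUnits {z : K} (hz : ∀ w ∈ logUnits K, ‖w‖ ≤ ‖z‖) : 0 < ‖z‖ := by
  have h := hz _ (prime_sq_mem_logUnits p K)
  have hp0 : (0 : ℝ) < ‖((p : K) ^ 2)‖ := by
    rw [norm_pow, norm_prime p K]
    have : (0 : ℝ) < p := by exact_mod_cast (Fact.out : p.Prime).pos
    positivity
  exact hp0.trans_le h

include p in
/-- Such an element is `≠ 0`. [cite: Mochizuki2012, IUTchIV Prop. 1.2 (i) p. 10] -/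
theorem ne_zero_of_isMaxOn_logUnits {z : K} (hz : ∀ w ∈ logUnits K, ‖w‖ ≤ ‖z‖) : z ≠ 0 :=
  norm_pos_iff.mp (norm_pos_of_isMaxOn_logUnits p K hz)

/-- Upper bound `‖z‖ ≤ p^{b}` for every `z ∈ log_p(R^×)` ([IUTchIV] Prop. 1.2 (i), `log_p(R^×) ⊆ p^{−b}·R`).
[cite: Mochizuki2012, IUTchIV Prop. 1.2 (i) p. 10] -/
theorem norm_le_rpow_logRadiusB_of_mem_logUnits {z : K} (hz : z ∈ logUnits K) :
    ‖z‖ ≤ (p : ℝ) ^ logRadiusB p (absRamificationIdx p K) := by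
  have h := (prop12i_holds p K).2 hz
  rw [mem_pBall_iff, neg_neg] at h
  exact h

/-- Lower bound `p^{−a} ≤ ‖z^max‖` for an element of largest norm ([IUTchIV] Prop. 1.2 (i), `p^a·R ⊆ log_p(R^×)`, applied
to an element of norm exactly `p^{−a}`). [cite: Mochizuki2012, IUTchIV Prop. 1.2 (i) p. 10] -/
theorem rpow_neg_logRadiusA_le_norm_of_isMaxOn {z : K} (hz : ∀ w ∈ logUnits K, ‖w‖ ≤ ‖z‖) :
    (p : ℝ) ^ (-logRadiusA p (absRamificationIdx p K)) ≤ ‖z‖ := by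
  obtain ⟨α, -, hα⟩ := exists_norm_eq_rpow_neg_logRadiusA p K
  rw [← hα]
  exact hz α ((prop12i_holds p K).1 (by rw [mem_pBall_iff, hα]))

/-- **Tame case**: if `p > 2` and `e ≤ p − 2`, an element of largest norm in `log_p(R^×) = 𝔪_K` has norm `p^{−1/e}` (a
uniformizer lies in `log_p(R^×)`; Prop. 1.2 (i) is an equality). [cite: Mochizuki2012, IUTchIV Prop. 1.2 (i) p. 10] -/
theorem norm_eq_of_isMaxOn_logUnits_of_tame (hp : 2 < p) (he : absRamificationIdx p K ≤ p - 2) {z : K}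
    (hzmem : z ∈ logUnits K) (hz : ∀ w ∈ logUnits K, ‖w‖ ≤ ‖z‖) :
    ‖z‖ = (p : ℝ) ^ (-(1 / (absRamificationIdx p K : ℝ))) := by
  have he1 := absRamificationIdx_pos p K
  obtain ⟨h1, -⟩ := prop12iEq_holds p K hp he
  have ha : logRadiusA p (absRamificationIdx p K) = 1 / (absRamificationIdx p K : ℝ) := logRadiusA_eq hp he1 he
  refine le_antisymm ?_ ?_
  · have h := hzmem
    rw [← h1, mem_pBall_iff, ha] at h
    exact h
  · have hϖ := norm_eq_rpow_of_isUniformizer p K (isUniformizer_unifChoice K)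
    rw [← hϖ]
    refine hz _ ?_
    rw [← h1, mem_pBall_iff, ha, hϖ]

end Factor

/-! ## The packet: `hull(log_p(R_I^×)) = (⊗ z_i^max)·(R_I)^∼` -/

section Packet

variable {I : Type} [Fintype I] [DecidableEq I]
variable (k : I → Type) [∀ i, NontriviallyNormedField (k i)] [∀ i, NormedAlgebra ℚ_[p] (k i)]
  [∀ i, IsUltrametricDist (k i)] [∀ i, ProperSpace (k i)]

omit [Fintype I] [DecidableEq I] in
include p in
/-- A family of elements of largest norm, one per factor, exists. [cite: Mochizuki2012, IUTchIV Prop. 1.2 (i) p. 10] -/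
theorem exists_family_isMaxOn_logUnits :
    ∃ z : Π i, k i, (∀ i, z i ∈ logUnits (k i)) ∧ ∀ i, ∀ w ∈ logUnits (k i), ‖w‖ ≤ ‖z i‖ := by
  choose z hz hmax using fun i => exists_norm_isMaxOn_logUnits p (k i)
  exact ⟨z, hz, hmax⟩

omit [Fintype I] [DecidableEq I] [∀ i, IsUltrametricDist (k i)] [∀ i, ProperSpace (k i)] in
/-- A pure tensor of elements of the `log_p(R_i^×)` lies in `log_p(R_I^×)` (a generator).
[cite: Mochizuki2012, IUTchIV Prop. 1.2 p. 10] -/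
theorem purePacket_mem_logPacket_of_mem {z : Π i, k i} (hz : ∀ i, z i ∈ logUnits (k i)) :
    purePacket p k z ∈ logPacket p k :=
  AddSubgroup.subset_closure ⟨z, hz, rfl⟩

omit [Fintype I] [DecidableEq I] in
/-- **`log_p(R_I^×) ⊆ (⊗_i z_i^max)·(R_I)^∼`** for a family `z^max` of elements of largest norm: each generator `⊗z_i`
is `(⊗z_i^max)·⊗(z_i/z_i^max)` with `‖z_i/z_i^max‖ ≤ 1`, and the translate is an additive subgroup.
[cite: Mochizuki2012, IUTchIV Prop. 1.2 (i) p. 10] [cite: DupuyHilado2025, §4.12] -/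
theorem logPacket_subset_purePacket_smul_normalizedPacket_of_isMaxOn {z : Π i, k i}
    (hz : ∀ i, ∀ w ∈ logUnits (k i), ‖w‖ ≤ ‖z i‖) :
    (logPacket p k : Set (PacketAlgebra p k)) ⊆ purePacket p k z • (normalizedPacket p k : Set (PacketAlgebra p k)) := by
  have hz0 : ∀ i, z i ≠ 0 := fun i => ne_zero_of_isMaxOn_logUnits p (k i) (hz i)
  have hle : logPacket p k ≤ (translateSubmodule p k (purePacket p k z)).toAddSubgroup := by
    refine (AddSubgroup.closure_le _).mpr ?_
    rintro _ ⟨x, hx, rfl⟩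
    rw [SetLike.mem_coe, Submodule.mem_toAddSubgroup, ← SetLike.mem_coe, coe_translateSubmodule]
    refine ⟨purePacket p k (fun i => x i / z i),
      integerPacket_le_normalizedPacket p k (purePacket_mem_integerPacket p k fun i => ?_), ?_⟩
    · rw [norm_div, div_le_one (norm_pos_iff.mpr (hz0 i))]
      exact hz i _ (hx i)
    · change purePacket p k z • purePacket p k (fun i => x i / z i) = purePacket p k x
      rw [smul_eq_mul, purePacket_mul]
      congr 1
      funext i
      rw [Pi.mul_apply, mul_div_cancel₀ _ (hz0 i)]
  intro w hw
  have h := hle hw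
  rwa [Submodule.mem_toAddSubgroup, ← SetLike.mem_coe, coe_translateSubmodule] at h

omit [Fintype I] [DecidableEq I] in
/-- **`hull(log_p(R_I^×)) = (⊗_i z_i^max)·(R_I)^∼`** for any family `z^max` of elements of largest norm in the
`log_p(R_i^×)`: `⊆` as the translate is hull-closed, `⊇` as `⊗z_i^max ∈ log_p(R_I^×)` and the hull is an
`(R_I)^∼`-submodule. [cite: DupuyHilado2025, §4.12] [cite: Mochizuki2012, IUTchIV Prop. 1.2 (i) p. 10] -/
theorem packetHull_logPacket_eq_purePacket_smul {z : Π i, k i} (hzmem : ∀ i, z i ∈ logUnits (k i))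
    (hz : ∀ i, ∀ w ∈ logUnits (k i), ‖w‖ ≤ ‖z i‖) :
    packetHull p k (logPacket p k : Set (PacketAlgebra p k)) =
      purePacket p k z • (normalizedPacket p k : Set (PacketAlgebra p k)) := by
  refine Set.Subset.antisymm
    (packetHull_subset_smul_normalizedPacket p k
      (logPacket_subset_purePacket_smul_normalizedPacket_of_isMaxOn p k hz)) ?_
  rintro _ ⟨y, hy, rfl⟩
  rw [packetHull_apply, SetLike.mem_coe]
  have hmem : purePacket p k z ∈ packetSpan p k (logPacket p k : Set (PacketAlgebra p k)) :=
    Submodule.subset_span (purePacket_mem_logPacket_of_mem p k hzmem)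
  have h := (packetSpan p k (logPacket p k : Set (PacketAlgebra p k))).smul_mem
    (⟨y, hy⟩ : normalizedPacket p k) hmem
  rw [Subring.smul_def, smul_eq_mul, mul_comm] at h
  exact h

variable [Nonempty I]

/-- **`log μ̄(hull(log_p(R_I^×))) = Σ_i log‖z_i^max‖`** for any family of elements of largest norm (every factor of
`ψ(⊗z^max)` has norm `∏‖z_i^max‖`, the weights sum to `1`). [cite: DupuyHilado2025, §3.7, §4.12]
[cite: Mochizuki2012, IUTchIV Prop. 1.4 (iii) proof p. 14] -/
theorem packetLogμ_packetHull_logPacket_eq_sum {z : Π i, k i} (hzmem : ∀ i, z i ∈ logUnits (k i))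
    (hz : ∀ i, ∀ w ∈ logUnits (k i), ‖w‖ ≤ ‖z i‖) :
    packetLogμ p k (packetHull p k (logPacket p k : Set (PacketAlgebra p k))) = ∑ i, Real.log ‖z i‖ := by
  have hz0 : ∀ i, z i ≠ 0 := fun i => ne_zero_of_isMaxOn_logUnits p (k i) (hz i)
  rw [packetHull_logPacket_eq_purePacket_smul p k hzmem hz]
  have h0 := packetLogVolume_ppow_mul_purePacket_smul p k (DFac p k) (dEquiv p k) 0 z hz0
  have h1 : ppow p k 0 = 1 := by rw [ppow, zpow_zero, map_one]
  rw [h1, one_mul, Int.cast_zero, zero_mul, neg_zero, zero_add] at h0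
  exact h0

/-- **`−a_I·log p ≤ log μ̄(hull(log_p(R_I^×))) ≤ b_I·log p`** (per factor `p^{−a_i} ≤ ‖z_i^max‖ ≤ p^{b_i}`).
[cite: Mochizuki2012, IUTchIV Prop. 1.2 (i) p. 10] -/
theorem packetLogμ_packetHull_logPacket_mem_Icc :
    -(aSum p k * Real.log p) ≤ packetLogμ p k (packetHull p k (logPacket p k : Set (PacketAlgebra p k))) ∧
      packetLogμ p k (packetHull p k (logPacket p k : Set (PacketAlgebra p k))) ≤ bSum p k * Real.log p := by
  obtain ⟨z, hzmem, hz⟩ := exists_family_isMaxOn_logUnits p k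
  have hp0 : (0 : ℝ) < p := by exact_mod_cast (Fact.out : p.Prime).pos
  rw [packetLogμ_packetHull_logPacket_eq_sum p k hzmem hz, aSum, bSum, Finset.sum_mul, Finset.sum_mul,
    ← Finset.sum_neg_distrib]
  refine ⟨Finset.sum_le_sum fun i _ => ?_, Finset.sum_le_sum fun i _ => ?_⟩
  · have h := Real.log_le_log (Real.rpow_pos_of_pos hp0 _) (rpow_neg_logRadiusA_le_norm_of_isMaxOn p (k i) (hz i))
    rw [Real.log_rpow hp0] at h
    linarith
  · have hpos := norm_pos_of_isMaxOn_logUnits p (k i) (hz i)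
    have h := Real.log_le_log hpos (norm_le_rpow_logRadiusB_of_mem_logUnits p (k i) (hzmem i))
    rwa [Real.log_rpow hp0] at h

/-- **Tame case: `log μ̄(hull(log_p(R_I^×))) = −(Σ_i 1/e_i)·log p`** (`p > 2`, every `e_i ≤ p − 2`: then
`log_p(R_i^×) = 𝔪_i` and `‖z_i^max‖ = p^{−1/e_i}`). [cite: Mochizuki2012, IUTchIV Prop. 1.2 (i) p. 10] -/
theorem packetLogμ_packetHull_logPacket_eq_of_tame (hp : 2 < p) (he : ∀ i, absRamificationIdx p (k i) ≤ p - 2) :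
    packetLogμ p k (packetHull p k (logPacket p k : Set (PacketAlgebra p k))) =
      -(∑ i, 1 / (absRamificationIdx p (k i) : ℝ)) * Real.log p := by
  obtain ⟨z, hzmem, hz⟩ := exists_family_isMaxOn_logUnits p k
  have hp0 : (0 : ℝ) < p := by exact_mod_cast (Fact.out : p.Prime).pos
  rw [packetLogμ_packetHull_logPacket_eq_sum p k hzmem hz, neg_mul, Finset.sum_mul, ← Finset.sum_neg_distrib]
  refine Finset.sum_congr rfl fun i _ => ?_
  rw [norm_eq_of_isMaxOn_logUnits_of_tame p (k i) hp (he i) (hzmem i) (hz i), Real.log_rpow hp0]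
  ring

/-- Tame case, in the text's letters: `log μ̄(hull(log_p(R_I^×))) = b_I·log p` (`b_i = −1/e_i` when `p > 2`,
`e_i ≤ p − 2`) — the upper estimate `≤ b_I·log p` of the Step (v) route is ATTAINED at tame packets.
[cite: Mochizuki2012, IUTchIV Prop. 1.2 (i) p. 10, Prop. 1.4 (iii) p. 13] -/
theorem packetLogμ_packetHull_logPacket_eq_bSum_of_tame (hp : 2 < p) (he : ∀ i, absRamificationIdx p (k i) ≤ p - 2) :
    packetLogμ p k (packetHull p k (logPacket p k : Set (PacketAlgebra p k))) = bSum p k * Real.log p := by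
  rw [packetLogμ_packetHull_logPacket_eq_of_tame p k hp he, bSum, ← Finset.sum_neg_distrib]
  congr 1
  exact Finset.sum_congr rfl fun i _ => (logRadiusB_eq hp (absRamificationIdx_pos p (k i)) (he i)).symm

end Packet

end Literature.IUT.LogVolume

end
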